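import Summits.Parity.GeneralizedHardyLittlewood.Theorems.LeeYangFibresCellParityLawP2Defs
import Literature.NumberTheory.LFunctions.RobinAnalytic
import HarnessLib

/-!
# Route `LeeYangFibres`, crux `CellParityLaw` (stmt-Parity-14109), line `section-annihilator`:
# tools for the registered stub `stub_modelPrimeSum` (the model prime sum with rate), part 1

Skeleton v18 (lead c5). Elementary bookkeeping for `ModelPrimeSum` (vocabulary file
`LeeYangFibresCellParityLawP2Defs`; the stub itself is proved in `LeeYangFibresCellParityLawModelPrimeSum`,
the integer-sum estimate in `LeeYangFibresCellParityLawModelPrimeSumIntegerSum`):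

* finite Abel summation over `Ioc a b` and the bounded variation of a product of a
  nonincreasing sequence in `[0, B]` and a nondecreasing one in `[0, 1]` (`sum_abs_sub_mul_le`);
* the Buchstab weight `G_j(t) = I_j(t)/t` (`I_j = roughCellDensity j`): `0 ≤ G_j ≤ 1`, the Lipschitz bound
  `|G_j(t) − G_j(t')| ≤ 2|t − t'|` on `[1, ∞)` (from `I_j(t) − I_j(t') ≤ t − t'`, i.e. `I_{j-1}(s)/s ≤ 1` under
  the integral of `roughCellDensity_succ`), its clipped continuous extension `G̃_j(s) = G_j(max s 1)`,
  and the right-endpoint Riemann-sum estimates for a nonincreasing sequence of mesh `≤ δ`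
  (`riemann_clipWeight`, `riemann_error`: `|Σ G(t_n)(t_n − t_{n+1}) − ∫_1^T G| ≤ 2δ · (length + 1)`);
* the mesh bound `lx/log v − lx/log w ≤ lx/(z log² z)` for `2 ≤ z ≤ v ≤ w ≤ v + 1` (`div_log_sub_div_log_mem`).

References: E. Bombieri, Rend. Accad. Naz. XL (5) 1/2 (1975/76) §1 [BombieriAsymptoticSieve1976];
K. Alladi, Quart. J. Math. Oxford (2) 33 (1982) [Alladi1982]; H. L. Montgomery, R. C. Vaughan,
*Multiplicative Number Theory I*, CUP (2007), §7.2 [MontgomeryVaughan2007].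
-/

noncomputable section

open scoped BigOperators Classical
open Finset Literature.NumberTheory.Sieve

namespace Summit.Parity.GeneralizedHardyLittlewood.Cruxes.CellParityLaw.SectionAnnihilator

namespace ModelPrimeSumAux

/-! ## Finite sums over `Ioc a b` -/

-- Telescoping over `Ioc a b` is `Literature.NumberTheory.LFunctions.RobinAnalytic.sum_Ioc_telescope`
-- (reused, not restated).

/-- **Abel summation** over `Ioc a b` (`a ≤ b`):
`Σ (U n − U (n+1)) Φ n = U(a+1) Φ(a+1) − U(b+1) Φ(b+1) + Σ U(n+1) (Φ(n+1) − Φ n)`. [folklore] -/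
theorem sum_Ioc_abel (U Φ : ℕ → ℝ) {a b : ℕ} (hab : a ≤ b) :
    ∑ n ∈ Ioc a b, (U n - U (n + 1)) * Φ n =
      U (a + 1) * Φ (a + 1) - U (b + 1) * Φ (b + 1) +
        ∑ n ∈ Ioc a b, U (n + 1) * (Φ (n + 1) - Φ n) := by
  induction b, hab using Nat.le_induction with
  | base => simp
  | succ b hab ih => rw [Finset.sum_Ioc_succ_top hab, Finset.sum_Ioc_succ_top hab, ih]; ring

/-- **Bounded variation of a product** on the integers `a+1, …, b+1`: if `f` is nonincreasing with values in
`[0, B]` and `h` is nondecreasing with values in `[0, 1]`, then `Σ_{a<n≤b} |f(n+1) h(n+1) − f n h n| ≤ 2B`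
(each difference is at most `(f n − f(n+1)) + B (h(n+1) − h n)`, and both sums telescope). [folklore] -/
theorem sum_abs_sub_mul_le (f h : ℕ → ℝ) {a b : ℕ} (hab : a ≤ b) {B : ℝ}
    (hf : ∀ n, a + 1 ≤ n → n ≤ b → f (n + 1) ≤ f n)
    (hh : ∀ n, a + 1 ≤ n → n ≤ b → h n ≤ h (n + 1))
    (hf0 : ∀ n, a + 1 ≤ n → n ≤ b + 1 → 0 ≤ f n ∧ f n ≤ B)
    (hh0 : ∀ n, a + 1 ≤ n → n ≤ b + 1 → 0 ≤ h n ∧ h n ≤ 1) :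
    ∑ n ∈ Ioc a b, |f (n + 1) * h (n + 1) - f n * h n| ≤ 2 * B := by
  obtain ⟨hfa0, hfaB⟩ := hf0 (a + 1) le_rfl (by omega)
  obtain ⟨hfb0, -⟩ := hf0 (b + 1) (by omega) le_rfl
  obtain ⟨hha0, -⟩ := hh0 (a + 1) le_rfl (by omega)
  obtain ⟨-, hhb1⟩ := hh0 (b + 1) (by omega) le_rfl
  have hB : 0 ≤ B := hfa0.trans hfaB
  have hpt : ∀ n ∈ Ioc a b, |f (n + 1) * h (n + 1) - f n * h n| ≤
      (f n - f (n + 1)) + B * (h (n + 1) - h n) := by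
    intro n hn
    rw [Finset.mem_Ioc] at hn
    have h1 := hf n hn.1 hn.2
    have h2 := hh n hn.1 hn.2
    obtain ⟨hfn0, hfnB⟩ := hf0 n hn.1 (by omega)
    obtain ⟨hfn0', -⟩ := hf0 (n + 1) (by omega) (by omega)
    obtain ⟨hhn0', hhn1'⟩ := hh0 (n + 1) (by omega) (by omega)
    have e : f (n + 1) * h (n + 1) - f n * h n =
        -((f n - f (n + 1)) * h (n + 1)) + f n * (h (n + 1) - h n) := by ring
    rw [e, abs_le]
    have i1 : 0 ≤ (f n - f (n + 1)) * h (n + 1) := mul_nonneg (sub_nonneg.mpr h1) hhn0'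
    have i1' : (f n - f (n + 1)) * h (n + 1) ≤ f n - f (n + 1) :=
      mul_le_of_le_one_right (sub_nonneg.mpr h1) hhn1'
    have i2 : 0 ≤ f n * (h (n + 1) - h n) := mul_nonneg hfn0 (sub_nonneg.mpr h2)
    have i2' : f n * (h (n + 1) - h n) ≤ B * (h (n + 1) - h n) :=
      mul_le_mul_of_nonneg_right hfnB (sub_nonneg.mpr h2)
    constructor <;> nlinarith
  calc ∑ n ∈ Ioc a b, |f (n + 1) * h (n + 1) - f n * h n|
      ≤ ∑ n ∈ Ioc a b, ((f n - f (n + 1)) + B * (h (n + 1) - h n)) := Finset.sum_le_sum hpt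
    _ = ∑ n ∈ Ioc a b, ((f n - B * h n) - (f (n + 1) - B * h (n + 1))) :=
        Finset.sum_congr rfl fun n _ => by ring
    _ = (f (a + 1) - B * h (a + 1)) - (f (b + 1) - B * h (b + 1)) :=
        Literature.NumberTheory.LFunctions.RobinAnalytic.sum_Ioc_telescope (fun n => f n - B * h n) hab
    _ ≤ 2 * B := by
        have : B * (h (b + 1) - h (a + 1)) ≤ B * 1 := mul_le_mul_of_nonneg_left (by linarith) hB
        linarith

/-! ## The Buchstab weight `G_j(t) = I_j(t)/t` -/

/-- `0 ≤ I_j(s)/s ≤ 1` for every real `s` (`j ≥ 1`): `I_j(s) ≤ s` for `s ≥ 1`, `I_j(s) = 0` for `s < 1`.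
[folklore] -/
theorem weight_mem_Icc {j : ℕ} (hj : 1 ≤ j) (s : ℝ) :
    0 ≤ roughCellDensity j s / s ∧ roughCellDensity j s / s ≤ 1 := by
  rcases lt_or_ge s 1 with hs | hs
  · rw [roughCellDensity_of_lt_one j hs, zero_div]
    exact ⟨le_rfl, zero_le_one⟩
  · have hs0 : 0 < s := by linarith
    exact ⟨div_nonneg (roughCellDensity_nonneg _ _) hs0.le,
      div_le_one_of_le₀ (roughCellDensity_le hj hs) hs0.le⟩

/-- `I_j(s)/s = I_j(s) · (max s 1)⁻¹` for every real `s` (both vanish for `s < 1`). [folklore] -/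
theorem weight_eq_mul_inv_max (j : ℕ) (s : ℝ) :
    roughCellDensity j s / s = roughCellDensity j s * (max s 1)⁻¹ := by
  rcases lt_or_ge s 1 with hs | hs
  · rw [roughCellDensity_of_lt_one j hs, zero_div, zero_mul]
  · rw [max_eq_left hs, div_eq_mul_inv]

/-- `I_j(t) − I_j(t') ≤ t − t'` for `2 ≤ t' ≤ t` and `j = k + 1 ≥ 2`: the difference is
`∫_{t'-1}^{t-1} I_k(s) ds/s` with integrand `≤ 1`. [folklore] -/
theorem roughCellDensity_sub_le_of_two_le {k : ℕ} (hk : 1 ≤ k) {t t' : ℝ} (ht' : 2 ≤ t')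
    (htt' : t' ≤ t) :
    roughCellDensity (k + 1) t - roughCellDensity (k + 1) t' ≤ t - t' := by
  have hI : ∀ c : ℝ, 1 ≤ c →
      IntervalIntegrable (fun s : ℝ => roughCellDensity k s / s) MeasureTheory.volume 1 c :=
    fun c hc => intervalIntegrable_roughCellDensity_div hk le_rfl hc
  rw [roughCellDensity_succ hk, roughCellDensity_succ hk,
    intervalIntegral.integral_interval_sub_left (hI _ (by linarith)) (hI _ (by linarith))]
  have hb := intervalIntegral.norm_integral_le_of_norm_le_const (a := t' - 1) (b := t - 1)
    (f := fun s : ℝ => roughCellDensity k s / s) (C := 1) fun s hs => by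
      rw [Set.uIoc_of_le (by linarith)] at hs
      have hs1 : 1 ≤ s := by linarith [hs.1]
      rw [Real.norm_eq_abs, abs_of_nonneg (weight_mem_Icc hk s).1]
      exact (weight_mem_Icc hk s).2
  rw [Real.norm_eq_abs, one_mul, abs_of_nonneg (by linarith : (0 : ℝ) ≤ t - 1 - (t' - 1))] at hb
  have := le_abs_self (∫ s in (t' - 1)..(t - 1), roughCellDensity k s / s)
  linarith

/-- `I_j(t) − I_j(t') ≤ t − t'` for `1 ≤ t' ≤ t`, every `j ≥ 1` (`I_1 ≡ 1` there; for `j ≥ 2`, `I_j`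
vanishes on `[1, 2]` and the previous lemma applies above `2`). [folklore] -/
theorem roughCellDensity_sub_le {j : ℕ} (hj : 1 ≤ j) {t t' : ℝ} (ht' : 1 ≤ t') (htt' : t' ≤ t) :
    roughCellDensity j t - roughCellDensity j t' ≤ t - t' := by
  rcases eq_or_lt_of_le hj with rfl | hj2
  · rw [roughCellDensity_one_of_one_le ht', roughCellDensity_one_of_one_le (ht'.trans htt')]
    linarith
  · obtain ⟨k, rfl⟩ : ∃ k, j = k + 1 := ⟨j - 1, by omega⟩
    have hk : 1 ≤ k := by omega
    have hk2 : (2 : ℝ) ≤ ((k + 1 : ℕ) : ℝ) := by push_cast; exact_mod_cast (show 2 ≤ k + 1 by omega)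
    rcases le_or_gt 2 t' with h2 | h2
    · exact roughCellDensity_sub_le_of_two_le hk h2 htt'
    · rw [roughCellDensity_of_le (j := k + 1) (by omega) (h2.le.trans hk2)]
      rcases le_or_gt t 2 with ht2 | ht2
      · rw [roughCellDensity_of_le (j := k + 1) (by omega) (ht2.trans hk2)]
        linarith
      · have h := roughCellDensity_sub_le_of_two_le hk (t' := 2) le_rfl ht2.le
        rw [roughCellDensity_of_le (j := k + 1) (by omega) hk2] at h
        linarith

/-- **Lipschitz bound for the weight**: `|I_j(t)/t − I_j(t')/t'| ≤ 2 (t − t')` for `1 ≤ t' ≤ t` (`j ≥ 1`).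
[folklore] -/
theorem abs_weight_sub_le {j : ℕ} (hj : 1 ≤ j) {t t' : ℝ} (ht' : 1 ≤ t') (htt' : t' ≤ t) :
    |roughCellDensity j t / t - roughCellDensity j t' / t'| ≤ 2 * (t - t') := by
  have ht0 : 0 < t := by linarith
  have ht'0 : 0 < t' := by linarith
  have hI0 : 0 ≤ roughCellDensity j t' := roughCellDensity_nonneg _ _
  have hIle : roughCellDensity j t' ≤ t' := roughCellDensity_le hj ht'
  have hmono : roughCellDensity j t' ≤ roughCellDensity j t := monotone_roughCellDensity j htt'
  have hsub : roughCellDensity j t - roughCellDensity j t' ≤ t - t' :=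
    roughCellDensity_sub_le hj ht' htt'
  have e : roughCellDensity j t / t - roughCellDensity j t' / t' =
      (roughCellDensity j t - roughCellDensity j t') / t -
        roughCellDensity j t' * (t - t') / (t * t') := by
    field_simp
    ring
  have hA0 : 0 ≤ (roughCellDensity j t - roughCellDensity j t') / t :=
    div_nonneg (sub_nonneg.mpr hmono) ht0.le
  have hA1 : (roughCellDensity j t - roughCellDensity j t') / t ≤ t - t' :=
    (div_le_self (sub_nonneg.mpr hmono) (by linarith)).trans hsub
  have hB0 : 0 ≤ roughCellDensity j t' * (t - t') / (t * t') :=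
    div_nonneg (mul_nonneg hI0 (by linarith)) (mul_pos ht0 ht'0).le
  have hB1 : roughCellDensity j t' * (t - t') / (t * t') ≤ t - t' := by
    rw [div_le_iff₀ (mul_pos ht0 ht'0)]
    have h1 : roughCellDensity j t' * (t - t') ≤ t' * (t - t') :=
      mul_le_mul_of_nonneg_right hIle (by linarith)
    have h2 : t' * (t - t') ≤ t' * (t - t') * t :=
      le_mul_of_one_le_right (mul_nonneg ht'0.le (by linarith)) (by linarith)
    nlinarith
  rw [e, abs_le]
  constructor <;> linarith

/-- **The clipped weight** `G̃_j(s) = I_j(max s 1)/max s 1` — equal to `I_j(s)/s` for `s ≥ 1` and to the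
constant `I_j(1)` below `1` — is continuous (`j ≥ 1`): `t ↦ I_j(t)/t` is continuous on `[1, ∞)`. [folklore] -/
theorem continuous_clipWeight {j : ℕ} (hj : 1 ≤ j) :
    Continuous fun s : ℝ => roughCellDensity j (max s 1) / max s 1 := by
  have h : Continuous ((fun t : ℝ => roughCellDensity j t / t) ∘ fun s : ℝ => max s 1) :=
    (continuousOn_roughCellDensity_div hj).comp_continuous (continuous_id.max continuous_const)
      fun s => le_max_right s 1
  exact h

/-- The clipped weight is `2`-Lipschitz on `ℝ` (`j ≥ 1`). [folklore] -/
theorem abs_clipWeight_sub_le {j : ℕ} (hj : 1 ≤ j) (s t : ℝ) :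
    |roughCellDensity j (max t 1) / max t 1 - roughCellDensity j (max s 1) / max s 1| ≤ 2 * |t - s| := by
  have hmax : |max t 1 - max s 1| ≤ |t - s| := abs_max_sub_max_le_abs t s 1
  rcases le_total (max s 1) (max t 1) with h | h
  · calc |roughCellDensity j (max t 1) / max t 1 - roughCellDensity j (max s 1) / max s 1|
        ≤ 2 * (max t 1 - max s 1) := abs_weight_sub_le hj (le_max_right _ _) h
      _ ≤ 2 * |t - s| := by linarith [le_abs_self (max t 1 - max s 1)]
  · rw [abs_sub_comm]
    calc |roughCellDensity j (max s 1) / max s 1 - roughCellDensity j (max t 1) / max t 1|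
        ≤ 2 * (max s 1 - max t 1) := abs_weight_sub_le hj (le_max_right _ _) h
      _ ≤ 2 * |t - s| := by linarith [neg_abs_le (max t 1 - max s 1)]

/-- **Right-endpoint Riemann sums of the weight.** For a sequence `t` that is nonincreasing on `a+1, …, b+1`,
of mesh `≤ δ`, with `t n ≥ 1` for `a < n ≤ b`:
`|Σ_{a<n≤b} G(t n)(t n − t (n+1)) − ∫_{t(b+1)}^{t(a+1)} G̃| ≤ 2δ (t(a+1) − t(b+1))`
(`G = I_j/·`, `G̃(s) = G(max s 1)`; on each piece `|G̃(t n) − G̃(s)| ≤ 2δ`). [folklore] -/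
theorem riemann_clipWeight {j : ℕ} (hj : 1 ≤ j) (t : ℕ → ℝ) {a b : ℕ} (hab : a ≤ b) {δ : ℝ}
    (hmono : ∀ n, a + 1 ≤ n → n ≤ b → t (n + 1) ≤ t n)
    (hmesh : ∀ n, a + 1 ≤ n → n ≤ b → t n - t (n + 1) ≤ δ)
    (hone : ∀ n, a + 1 ≤ n → n ≤ b → 1 ≤ t n) :
    |∑ n ∈ Ioc a b, roughCellDensity j (t n) / t n * (t n - t (n + 1)) -
        ∫ s in t (b + 1)..t (a + 1), roughCellDensity j (max s 1) / max s 1| ≤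
      2 * δ * (t (a + 1) - t (b + 1)) := by
  set G : ℝ → ℝ := fun s => roughCellDensity j (max s 1) / max s 1 with hG
  have hint : ∀ c d : ℝ, IntervalIntegrable G MeasureTheory.volume c d :=
    fun c d => (continuous_clipWeight hj).intervalIntegrable c d
  have hsplit : ∀ b', a ≤ b' → ∑ n ∈ Ioc a b', ∫ s in t (n + 1)..t n, G s =
      ∫ s in t (b' + 1)..t (a + 1), G s := by
    intro b' hab'
    induction b', hab' using Nat.le_induction with
    | base => simp
    | succ b' hab' ih =>
      rw [Finset.sum_Ioc_succ_top hab', ih, add_comm,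
        intervalIntegral.integral_add_adjacent_intervals (hint _ _) (hint _ _)]
  show |∑ n ∈ Ioc a b, roughCellDensity j (t n) / t n * (t n - t (n + 1)) -
      ∫ s in t (b + 1)..t (a + 1), G s| ≤ 2 * δ * (t (a + 1) - t (b + 1))
  rw [← hsplit b hab, ← Finset.sum_sub_distrib]
  have hpt : ∀ n ∈ Ioc a b, |roughCellDensity j (t n) / t n * (t n - t (n + 1)) -
      ∫ s in t (n + 1)..t n, G s| ≤ 2 * δ * (t n - t (n + 1)) := by
    intro n hn
    rw [Finset.mem_Ioc] at hn
    have h1 := hone n hn.1 hn.2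
    have h2 := hmono n hn.1 hn.2
    have h3 := hmesh n hn.1 hn.2
    have e1 : roughCellDensity j (t n) / t n * (t n - t (n + 1)) = ∫ _ in t (n + 1)..t n, G (t n) := by
      rw [intervalIntegral.integral_const, smul_eq_mul, hG]
      simp only [max_eq_left h1]
      ring
    have e2 : (∫ _ in t (n + 1)..t n, G (t n)) - ∫ s in t (n + 1)..t n, G s =
        ∫ s in t (n + 1)..t n, (G (t n) - G s) :=
      (intervalIntegral.integral_sub intervalIntegrable_const (hint _ _)).symm
    rw [e1, e2]
    have hb := intervalIntegral.norm_integral_le_of_norm_le_const (a := t (n + 1)) (b := t n)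
      (f := fun s : ℝ => G (t n) - G s) (C := 2 * δ) fun s hs => by
        rw [Set.uIoc_of_le h2] at hs
        rw [Real.norm_eq_abs]
        calc |G (t n) - G s| ≤ 2 * |t n - s| := abs_clipWeight_sub_le hj s (t n)
          _ ≤ 2 * δ := by rw [abs_of_nonneg (by linarith [hs.2])]; linarith [hs.1]
    rw [Real.norm_eq_abs, abs_of_nonneg (sub_nonneg.mpr h2)] at hb
    exact hb
  calc |∑ n ∈ Ioc a b, (roughCellDensity j (t n) / t n * (t n - t (n + 1)) -
          ∫ s in t (n + 1)..t n, G s)|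
      ≤ ∑ n ∈ Ioc a b, |roughCellDensity j (t n) / t n * (t n - t (n + 1)) -
          ∫ s in t (n + 1)..t n, G s| := Finset.abs_sum_le_sum_abs _ _
    _ ≤ ∑ n ∈ Ioc a b, 2 * δ * (t n - t (n + 1)) := Finset.sum_le_sum hpt
    _ = 2 * δ * (t (a + 1) - t (b + 1)) := by
        rw [← Finset.mul_sum, Literature.NumberTheory.LFunctions.RobinAnalytic.sum_Ioc_telescope t hab]

/-! ## Riemann sums of the weight against `∫_1^T` -/

/-- **Riemann-sum error.** For a sequence `t`, nonincreasing on `a+1, …, b+1`, of mesh `≤ δ`, with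
`t n ≥ 1` for `a < n ≤ b`, top `T − δ ≤ t(a+1) ≤ T` (`T ≥ 1`) and bottom `1 − δ ≤ t(b+1) ≤ 1`:
`|Σ_{a<n≤b} G(t n)(t n − t(n+1)) − ∫_1^T G| ≤ 2δ (T − t(b+1)) + 2δ`, `G = I_m/·` (`riemann_clipWeight`
plus the two end pieces of length `≤ δ`, on which `0 ≤ G̃ ≤ 1`). [folklore] -/
theorem riemann_error {m : ℕ} (hm : 1 ≤ m) (t : ℕ → ℝ) {a b : ℕ} (hab : a ≤ b) {δ T : ℝ} (hT : 1 ≤ T)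
    (hmono : ∀ n, a + 1 ≤ n → n ≤ b → t (n + 1) ≤ t n)
    (hmesh : ∀ n, a + 1 ≤ n → n ≤ b → t n - t (n + 1) ≤ δ)
    (hone : ∀ n, a + 1 ≤ n → n ≤ b → 1 ≤ t n)
    (htop : t (a + 1) ≤ T) (htop' : T - t (a + 1) ≤ δ)
    (hbot : t (b + 1) ≤ 1) (hbot' : 1 - t (b + 1) ≤ δ) :
    |∑ n ∈ Ioc a b, roughCellDensity m (t n) / t n * (t n - t (n + 1)) -
        ∫ s in (1 : ℝ)..T, roughCellDensity m s / s| ≤ 2 * δ * (T - t (b + 1)) + 2 * δ := by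
  have hδ : 0 ≤ δ := le_trans (sub_nonneg.mpr htop) htop'
  set G : ℝ → ℝ := fun s => roughCellDensity m (max s 1) / max s 1 with hG
  have hG01 : ∀ s, 0 ≤ G s ∧ G s ≤ 1 := fun s => weight_mem_Icc hm (max s 1)
  have hint : ∀ c d : ℝ, IntervalIntegrable G MeasureTheory.volume c d :=
    fun c d => (continuous_clipWeight hm).intervalIntegrable c d
  have hR : |∑ n ∈ Ioc a b, roughCellDensity m (t n) / t n * (t n - t (n + 1)) -
      ∫ s in t (b + 1)..t (a + 1), G s| ≤ 2 * δ * (t (a + 1) - t (b + 1)) :=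
    riemann_clipWeight hm t hab hmono hmesh hone
  have e1 : ∫ s in (1 : ℝ)..T, roughCellDensity m s / s = ∫ s in (1 : ℝ)..T, G s := by
    refine intervalIntegral.integral_congr fun s hs => ?_
    rw [Set.uIcc_of_le hT] at hs
    simp only [hG, max_eq_left hs.1]
  have e2 : ∫ s in t (b + 1)..t (a + 1), G s =
      (∫ s in t (b + 1)..(1 : ℝ), G s) + ((∫ s in (1 : ℝ)..T, G s) - ∫ s in t (a + 1)..T, G s) := by
    rw [← intervalIntegral.integral_add_adjacent_intervals (hint (t (b + 1)) 1) (hint 1 (t (a + 1))),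
      ← intervalIntegral.integral_add_adjacent_intervals (hint 1 (t (a + 1))) (hint (t (a + 1)) T)]
    ring
  have hend : ∀ c d : ℝ, |∫ s in c..d, G s| ≤ |d - c| := by
    intro c d
    have h := intervalIntegral.norm_integral_le_of_norm_le_const (a := c) (b := d)
      (f := G) (C := 1) fun s _ => by
        rw [Real.norm_eq_abs, abs_of_nonneg (hG01 s).1]
        exact (hG01 s).2
    rw [Real.norm_eq_abs, one_mul] at h
    exact h
  have h3 : |∫ s in t (b + 1)..(1 : ℝ), G s| ≤ δ := by
    refine (hend _ _).trans ?_
    rw [abs_of_nonneg (sub_nonneg.mpr hbot)]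
    exact hbot'
  have h4 : |∫ s in t (a + 1)..T, G s| ≤ δ := by
    refine (hend _ _).trans ?_
    rw [abs_of_nonneg (sub_nonneg.mpr htop)]
    exact htop'
  have h5 : 2 * δ * (t (a + 1) - t (b + 1)) ≤ 2 * δ * (T - t (b + 1)) :=
    mul_le_mul_of_nonneg_left (by linarith) (by linarith)
  have e3 : ∑ n ∈ Ioc a b, roughCellDensity m (t n) / t n * (t n - t (n + 1)) -
      ∫ s in (1 : ℝ)..T, roughCellDensity m s / s =
      (∑ n ∈ Ioc a b, roughCellDensity m (t n) / t n * (t n - t (n + 1)) -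
        ∫ s in t (b + 1)..t (a + 1), G s) +
      (∫ s in t (b + 1)..(1 : ℝ), G s) - ∫ s in t (a + 1)..T, G s := by
    rw [e1, e2]
    ring
  obtain ⟨hRl, hRr⟩ := abs_le.mp hR
  obtain ⟨h3l, h3r⟩ := abs_le.mp h3
  obtain ⟨h4l, h4r⟩ := abs_le.mp h4
  rw [e3, abs_le]
  constructor <;> linarith

/-! ## The mesh of `n ↦ log x/log n` -/

/-- Mesh bound: for `2 ≤ z ≤ v ≤ w ≤ v + 1` and `lx ≥ 0`, `0 ≤ lx/log v − lx/log w ≤ lx/(z (log z)²)`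
(`log w − log v ≤ (w − v)/v ≤ 1/z`). [folklore] -/
theorem div_log_sub_div_log_mem {lx z v w : ℝ} (hlx : 0 ≤ lx) (hz : 2 ≤ z) (hzv : z ≤ v) (hvw : v ≤ w)
    (hwv : w ≤ v + 1) :
    0 ≤ lx / Real.log v - lx / Real.log w ∧
      lx / Real.log v - lx / Real.log w ≤ lx / (z * Real.log z ^ 2) := by
  have hv0 : 0 < v := by linarith
  have hw0 : 0 < w := by linarith
  have hlz : 0 < Real.log z := Real.log_pos (by linarith)
  have hlv : Real.log z ≤ Real.log v := Real.log_le_log (by linarith) hzv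
  have hlw : Real.log v ≤ Real.log w := Real.log_le_log hv0 hvw
  have hlv0 : 0 < Real.log v := by linarith
  have hlw0 : 0 < Real.log w := by linarith
  refine ⟨sub_nonneg.mpr (div_le_div_of_nonneg_left hlx hlv0 hlw), ?_⟩
  have hdiff : Real.log w - Real.log v ≤ 1 / z := by
    rw [← Real.log_div hw0.ne' hv0.ne']
    have h1 : Real.log (w / v) ≤ w / v - 1 := Real.log_le_sub_one_of_pos (div_pos hw0 hv0)
    have h2 : w / v - 1 ≤ 1 / z := by
      rw [div_sub_one hv0.ne', div_le_div_iff₀ hv0 (by linarith)]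
      nlinarith
    linarith
  have h3 : (Real.log w - Real.log v) * z ≤ 1 := by
    rw [← le_div_iff₀ (by linarith : (0 : ℝ) < z)]
    exact hdiff
  have h4 : Real.log z ^ 2 ≤ Real.log v * Real.log w := by
    rw [sq]
    exact mul_le_mul hlv (hlv.trans hlw) hlz.le hlv0.le
  rw [div_sub_div _ _ hlv0.ne' hlw0.ne', div_le_div_iff₀ (mul_pos hlv0 hlw0) (by positivity)]
  calc (lx * Real.log w - Real.log v * lx) * (z * Real.log z ^ 2)
      = lx * ((Real.log w - Real.log v) * z) * Real.log z ^ 2 := by ring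
    _ ≤ lx * 1 * Real.log z ^ 2 :=
        mul_le_mul_of_nonneg_right (mul_le_mul_of_nonneg_left h3 hlx) (sq_nonneg _)
    _ ≤ lx * (Real.log v * Real.log w) := by
        rw [mul_one]
        exact mul_le_mul_of_nonneg_left h4 hlx

end ModelPrimeSumAux

/-- **`stub_buchstabWeightLipschitz`** (registered sub-goal of the line, carried by this auxiliary file): the
Buchstab weight `t ↦ I_j(t)/t` is `2`-Lipschitz on `[1, ∞)` (`ModelPrimeSumAux.abs_weight_sub_le`). -/
theorem stub_buchstabWeightLipschitz : ∀ (j : ℕ), 1 ≤ j → ∀ (t u : ℝ), 1 ≤ u → u ≤ t → |roughCellDensity j t / t - roughCellDensity j u / u| ≤ 2 * (t - u) :=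
  fun _ hj _ _ hu hut => ModelPrimeSumAux.abs_weight_sub_le hj hu hut

end Summit.Parity.GeneralizedHardyLittlewood.Cruxes.CellParityLaw.SectionAnnihilator

end
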